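import Literature.IUT.HodgeTheaters.TemperedCoveringsCor23KerLevelOfHPrime
import Literature.IUT.HodgeTheaters.TemperedCoveringsCor23LevelsSubProofs
import Literature.IUT.HodgeTheaters.TemperedCoveringsProp24SubProofs
import Literature.IUT.HodgeTheaters.TemperedCoveringsSubgraphClosures
import Literature.IUT.HodgeTheaters.TemperedCoveringsProSigmaInertia
import Literature.IUT.HodgeTheaters.StableCurveTemperedDataOfSpecialFibreCor25
import HarnessLib

/-!
# Input (y) «`N_i ≠ 1`» of the (H′) route to [IUTchI] Cor. 2.3 (iii)'s KER-LEVEL at EVERY level from ONE level-free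
# input: the admissible quotient `Δ^tp_X ↠ Π^tp_𝔾` is a PROPER quotient (row «KER-LEVEL-Y-LEVEL-FREE»)

Mochizuki, *Inter-universal Teichmüller theory I: construction of Hodge theaters*, kurims manuscript (May 2020), §2,
Cor. 2.3 (iii), proof p. 48 l. 44 – p. 49 l. 5 [cite: Mochizuki2012, Cor 2.3(iii) pp.48-49] (D-0012 claim key; series status
DISPUTED; nothing of the series is asserted here); Mochizuki, *Semi-graphs of anabelioids*, Publ. RIMS **42** (2006), Ex. 3.10
pp. 43–45 ("the natural quotient `Δ ↠ π₁^temp(G) ≅ π₁^temp(G^c)`", "we thus conclude that both `Δ` and `Π` are temp-slim"),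
proof of Cor. 3.11 p. 48 l. 9–24 ("A normal open subgroup of finite index `Δ′ ⊆ Δ` arises from this quotient if and only if …
the decomposition groups at the nodes and cusps … are prime to `p` … [there exist `Δ′` for which `I_v` is nontrivial]"), §6
p. 71 ("`I_x` is isomorphic to `Ẑ(1)` if `x` is a cusp") [cite: MochizukiSemiAnbd2006, Ex 3.10 pp.43-45; Cor 3.11 p.48; §6 p.71].

PROOF-ONLY (abc-iut cell; seat abc-iut-w4-d052 gen 7; row «KER-LEVEL-Y-LEVEL-FREE» on IUTchI:Cor2.3(iii)/(iv)).  The (H′) route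
to the KER-LEVEL laws `hA`/`hB` of [IUTchI] Cor. 2.3 (iii) (`TemperedCoveringsCor23KerLevelOfHPrime.lean`, p485924) has three
displayed inputs: (x) «`Δ̂_X` is a pro-`Σ′` completion of a nonabelian free group», (z) «`Σ′` unbounded», and the per-LEVEL law
(y) «`N_i := (Ĵ_i ∩ Δ̂_X) ∩ Ker(Δ̂_X ↠ Π̂_𝔾) ≠ 1` for every level `i` of the tower» (GAP-LEDGER G-w4d052-g6-3; reduced in
`TemperedCoveringsCor23KerLevelOfHPrimeInputs.lean`, p486906, to per-vertex print inputs at one vertex per level — inputs the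
tree cannot instantiate today, no X-side decomposition-group record).  THIS FILE derives (y) at EVERY level from ONE LEVEL-FREE
input by pure group theory:

  (y′) «the quotient `Δ^tp_X ↠ Π^tp_𝔾` is PROPER» — at the genuine datum, `Ker(S.admissible) ≠ 1` for the admissible quotient
  `Δ^temp_X ↠ π₁^temp(G^c)` of the special-fibre datum `S` ([SemiAnbd] Ex. 3.10).

ARGUMENT.  The tempered level `J_i := Δ^tp_X ∩ ι⁻¹(Ĵ_i)` is an OPEN NORMAL subgroup of `Δ^tp_X` (tower laws `LevelsOpen`,
`LevelsNormal`, continuity of `ι`), and `K := Ker(Δ^tp_X ↠ Π^tp_𝔾)` is normal.  If `N_i = 1`, then `K ∩ J_i = 1` (a common element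
maps by the injective `ι` into `N_i`, by the compatibility `ρ̂ ∘ ι = ι_𝔾 ∘ ρ^tp`), so `[K, J_i] ⊆ K ∩ J_i = 1`, i.e. `K`
centralises the open subgroup `J_i`; but `Δ^tp_X` is temp-SLIM ([SemiAnbd] Ex. 3.10 p. 45 — a RECORDED field of the bridged
group-level datum, `GroupLevelData.isSlimGroup_ker`), so `K ⊆ Z_{Δ^tp_X}(J_i) = 1`, contradicting (y′).  AND (y′) itself follows
from a CUSP: `I_x ≅ Ẑ(1)` (a recorded field, [SemiAnbd] §6 p. 71) contains a non-trivial compact pro-`p` subgroup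
(abc-iut-L5-t11's `exists_compact_proSigma_le_of_mulEquiv_zHat`), whose image in `Π̂_𝔾` is pro-`p` and lies in a closed pro-`Σ_c`
subgroup with `p ∉ Σ_c` (print: the cuspidal edge group of the pro-`Σ` semi-graph of anabelioids `𝔾`, `p ∉ Σ` — [IUTchI] §2
p. 47; [SemiAnbd] Cor. 3.11 p. 48 «the decomposition groups at the … cusps … are prime to `p`»), hence is trivial.

* §A `eq_bot_of_isSlimGroup_of_inf_eq_bot` (slim groups), `monoidHom_apply_eq_one_of_isProSigma_singleton_of_not_mem`
  (compact pro-`p` → closed pro-`Σ`, `p ∉ Σ`, is trivial) — generic;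
* §B `inf_ker_ne_bot_towerLevels_of_isSlimGroup` — (y) at every level of ANY `Prop24Tower` with open normal levels over ANY
  `StableCurveTemperedData` with slim `Δ^tp_X`, from `Ker(ρ^tp) ≠ 1`; `ker_ρTp_ne_bot_of_cusp` — `Ker(ρ^tp) ≠ 1` from a cusp;
* §C at the genuine 𝔛-datum: `ofSpecialFibre_isSlimGroup_deltaTp` (temp-slimness BY NAME), `ofSpecialFibre_continuous_ρTp`,
  `ofSpecialFibre_ker_ρTp_ne_bot_iff` (`Ker(ρ^tp) ≠ 1 ↔ Ker(S.admissible) ≠ 1`),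
  `inf_ker_ne_bot_towerLevels_ofSpecialFibre_of_admissibleKer_ne_bot` ((y) ⇐ (y′); levels open/normal are THEOREMS,
  `towerOfSpecialFibreTower_levelsOpen/_levelsNormal`), `admissibleKer_ne_bot_ofSpecialFibre_of_cusp` ((y′) ⇐ cusp + container);
* §D the Cor. 2.3 (i)–(v) block at the record's `ℍ` on the (H′) route with (y) DERIVED:
  `cor23_i_to_v_ofSpecialFibre_closureH_of_piData_of_mem_decompSubgroups_of_hPrime_of_admissibleKer_ne_bot` (feed it
  `admissibleKer_ne_bot_ofSpecialFibre_of_cusp` for the cusp form; the spelled-out cusp headline is the sequel file).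

BINDER CENSUS of the §D headlines (classes of L5-lead RULINGS #101 (2) / #108): DATA = `X`, `d`, `S`, `Σ`/`Σ̂` + side conditions,
`TpH`, `hTpH`, `cuspMeetsH`, `T`, `P`, (z) `hSig` · DATUM-INTERNAL = `h36`, `S.hyp`, origin datum `hind : P.ActGraphInduces` ·
FACT-INSTANCE = `hcoh` ((v) only) and, IN SHAPE, (x) `hΓ`/`hι` (GAP G-w4d052-g6-2, affine `X`) · the ONE level-free input
(y′) `hK : S.admissible.toMonoidHom.ker ≠ ⊥` («the admissible quotient is proper» — a property of the genuine special-fibre datum,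
[SemiAnbd] Cor. 3.11 p. 48 l. 22–23), resp. via `admissibleKer_ne_bot_ofSpecialFibre_of_cusp`: a cusp `x` (DATA; [IUTchI]'s
`X_K`, `C_K` are affine) and a closed
pro-`Σ_c` subgroup `W ⊆ Π̂_𝔾`, `p ∉ Σ_c`, containing the image of `I_x` (the cuspidal edge group of the pro-`Σ` `𝔾`: the
cusp ↦ open-edge dictionary atom of G-w5d028-2 (P5) together with print's standing hypothesis «`𝔾` pro-`Σ`, `p ∉ Σ`») · LAW = none;
the per-level / per-vertex inputs of p486906 are GONE.  HONEST LIMITS: (H′) is not print's route and needs `Σ′` unbounded (so it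
covers `Σ̂ = 𝔓𝔯𝔦𝔪𝔢𝔰` = the [IUTchII] Cor. 2.4 (i) application and any unbounded `Σ̂`; finite `Σ̂` under guard (a) stays on `hA`);
(y′) is FALSE for abstract special-fibre data whose admissible quotient is injective (so it is a genuine input, not a theorem of
the interface); model-RELATIVE; typed ≠ discharged; no definition, no instance, no new `Prop` fact; nothing here bears on
[IUTchIII] Cor. 3.12 or asserts that abc is proved or refuted.
-/

noncomputable section

namespace Literature.IUT.HodgeTheaters

open _root_.Topology
open scoped Pointwise
open Literature.AlgebraicGeometry.Frobenioids (IsSlimGroup)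
open Literature.AnabelianGeometry.SemiGraphs
open Literature.AnabelianGeometry.SemiGraphs.SemiGraphOfAnabelioids (IsProSigmaCompletion)

universe u

/-! ### A. Two generic lemmas: slim groups; pro-`p` images inside pro-`Σ` groups with `p ∉ Σ` -/

section Generic

/-- **In a slim topological group, a normal subgroup that meets an OPEN normal subgroup trivially is trivial**:
`[K, J] ⊆ K ∩ J = 1`, so `K` centralises the open subgroup `J`, and `Z_G(J) = 1` by slimness ([FrdI] §0 p. 13
«slim»; [SemiAnbd] Ex. 3.10 p. 45 «`Δ` [is] temp-slim»). [cite: MochizukiSemiAnbd2006, Ex 3.10 p.45] -/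
theorem eq_bot_of_isSlimGroup_of_inf_eq_bot {G : Type*} [Group G] [TopologicalSpace G] (hG : IsSlimGroup G)
    (J K : Subgroup G) [J.Normal] [K.Normal] (hJ : IsOpen (J : Set G)) (hKJ : K ⊓ J = ⊥) : K = ⊥ := by
  have hle : K ≤ Subgroup.centralizer (J : Set G) := by
    intro k hk
    rw [Subgroup.mem_centralizer_iff]
    intro j hj
    -- the commutator `k j k⁻¹ j⁻¹` lies in `K ∩ J = 1`
    have h1 : k * j * k⁻¹ * j⁻¹ ∈ K ⊓ J := by
      refine Subgroup.mem_inf.mpr ⟨?_, ?_⟩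
      · have hc : j * k⁻¹ * j⁻¹ ∈ K := Subgroup.Normal.conj_mem inferInstance k⁻¹ (K.inv_mem hk) j
        have hm : k * (j * k⁻¹ * j⁻¹) ∈ K := K.mul_mem hk hc
        simpa only [mul_assoc] using hm
      · have hc : k * j * k⁻¹ ∈ J := Subgroup.Normal.conj_mem inferInstance j hj k
        exact J.mul_mem hc (J.inv_mem hj)
    rw [hKJ, Subgroup.mem_bot] at h1
    have hkj : k * j = j * k := by
      calc k * j = k * j * k⁻¹ * j⁻¹ * (j * k) := by group
        _ = j * k := by rw [h1, one_mul]
    exact hkj.symm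
  rw [hG.centralizer_eq_bot J hJ] at hle
  exact le_bot_iff.mp hle

/-- **A continuous homomorphism from a compact pro-`p` group into a CLOSED pro-`Σ` subgroup of a profinite group, `p ∉ Σ`,
is trivial**: its image is pro-`p` (continuous image) and pro-`Σ` (subgroup of a profinite pro-`Σ` group), and a non-trivial
profinite group has a non-trivial finite quotient, whose order has a prime factor — which would be `p ∈ Σ`.
[cite: MochizukiCombGC2007, Def 1.1(ii) p.6] -/
theorem monoidHom_apply_eq_one_of_isProSigma_singleton_of_not_mem {A : Type*} [Group A] [TopologicalSpace A]
    [IsTopologicalGroup A] [CompactSpace A] {B : Type*} [Group B] [TopologicalSpace B] [IsTopologicalGroup B]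
    [CompactSpace B] [T2Space B] [TotallyDisconnectedSpace B] (f : A →* B) (hf : Continuous f) {p : ℕ}
    (hA : IsProSigma {p} A) {S : Set ℕ} (hpS : p ∉ S) (W : Subgroup B) (hWc : IsClosed (W : Set B))
    (hW : IsProSigma S W) (hfW : f.range ≤ W) : ∀ a, f a = 1 := by
  -- the image `R`
  set R : Subgroup B := f.range with hR
  -- `R` is pro-`p`
  have hRp : IsProSigma {p} R :=
    isProSigma_of_surjective hA f.rangeRestrict (hf.subtype_mk _) f.rangeRestrict_surjective
  -- `R` is pro-`Σ`: a subgroup of the profinite pro-`Σ` group `W`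
  haveI : CompactSpace W := isCompact_iff_compactSpace.mp hWc.isCompact
  have hRS : IsProSigma S R := by
    have h1 : IsProSigma S (R.subgroupOf W) := isProSigma_subgroup hW _
    refine isProSigma_of_surjective h1 (Subgroup.subgroupOfEquivOfLe hfW).toMonoidHom ?_
      (Subgroup.subgroupOfEquivOfLe hfW).surjective
    exact (continuous_subtype_val.comp continuous_subtype_val).subtype_mk _
  -- `R` is profinite
  have hRc : IsClosed (R : Set B) := by
    have : (R : Set B) = Set.range f := by rw [hR, MonoidHom.coe_range]
    rw [this]
    exact (isCompact_range hf).isClosed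
  haveI : CompactSpace R := isCompact_iff_compactSpace.mp hRc.isCompact
  -- `R = 1`
  suffices hbot : R = ⊥ by
    intro a
    have : f a ∈ R := ⟨a, rfl⟩
    rwa [hbot, Subgroup.mem_bot] at this
  by_contra hne
  obtain ⟨r, hrR, hr1⟩ : ∃ r ∈ R, r ≠ (1 : B) := by
    by_contra h
    push Not at h
    exact hne ((Subgroup.eq_bot_iff_forall _).mpr h)
  -- an open normal subgroup of `R` missing `r`
  have hopen : IsOpen ({⟨r, hrR⟩}ᶜ : Set R) := isOpen_compl_singleton
  have hone : (1 : R) ∈ ({⟨r, hrR⟩}ᶜ : Set R) := by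
    rw [Set.mem_compl_singleton_iff]
    intro h
    exact hr1 (congrArg Subtype.val h).symm
  obtain ⟨N, hN⟩ := ProfiniteGrp.exist_openNormalSubgroup_sub_open_nhds_of_one hopen hone
  haveI : Finite (R ⧸ N.toSubgroup) := Subgroup.quotient_finite_of_isOpen _ N.isOpen'
  have hrN : (⟨r, hrR⟩ : R) ∉ N.toSubgroup := fun h => by
    have := hN h
    rw [Set.mem_compl_singleton_iff] at this
    exact this rfl
  haveI : Nontrivial (R ⧸ N.toSubgroup) := by
    refine ⟨⟨QuotientGroup.mk ⟨r, hrR⟩, 1, ?_⟩⟩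
    intro h
    exact hrN ((QuotientGroup.eq_one_iff _).mp h)
  have hcard : Nat.card (R ⧸ N.toSubgroup) ≠ 1 := (Finite.one_lt_card).ne'
  obtain ⟨q, hq, hqdvd⟩ := Nat.exists_prime_and_dvd hcard
  have hqp : q ∈ ({p} : Set ℕ) := hRp.prime_mem N inferInstance q hq hqdvd
  have hqS : q ∈ S := hRS.prime_mem N inferInstance q hq hqdvd
  rw [Set.mem_singleton_iff] at hqp
  exact hpS (hqp ▸ hqS)

end Generic

namespace StableCurveTemperedData

/-! ### B. Abstract [IUTchI] §2 data: (y) at every tower level from «`Ker(Δ^tp_X ↠ Π^tp_𝔾) ≠ 1`» and temp-slimness -/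

section Abstract

variable (D : StableCurveTemperedData.{u}) (T : D.Prop24Tower)

/-- A tempered element of a level `J_i = Δ^tp_X ∩ ι⁻¹(Ĵ_i)` killed by `Δ^tp_X ↠ Π^tp_𝔾` maps by `ι_Δ` into
`N_i = (Ĵ_i ∩ Δ̂_X) ∩ Ker(Δ̂_X ↠ Π̂_𝔾)` (compatibility `ρ̂ ∘ ι_Δ = ι_𝔾 ∘ ρ^tp`, p. 47). [cite: Mochizuki2012, Cor 2.3 p.47] -/
theorem ιΔ_mem_inf_ker_of_mem_levelTp (i : T.I) {x : D.DeltaTp} (hx : x ∈ D.levelTp (T.Jhat i))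
    (hk : x ∈ D.ρTp.ker) : D.ιΔ x ∈ (T.Jhat i).subgroupOf D.DeltaHat ⊓ D.ρHat.ker := by
  refine Subgroup.mem_inf.mpr ⟨?_, ?_⟩
  · rw [Subgroup.mem_subgroupOf, coe_ιΔ]
    exact D.mem_levelTp.mp hx
  · rw [MonoidHom.mem_ker, D.ρHat_ιΔ, MonoidHom.mem_ker.mp hk, map_one]

/-- **(y) at EVERY level from ONE level-free input**, abstract form: for a tower with OPEN and NORMAL levels over data
whose `Δ^tp_X` is (temp-)slim, if the quotient `Δ^tp_X ↠ Π^tp_𝔾` is PROPER (`Ker ≠ 1`), then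
`N_i := (Ĵ_i ∩ Δ̂_X) ∩ Ker(Δ̂_X ↠ Π̂_𝔾) ≠ 1` for every `i`.  [If `N_i = 1` then the normal subgroup `Ker(ρ^tp)` of `Δ^tp_X`
meets the open normal level `J_i` trivially (`ι_Δ` is injective), so it is trivial by slimness.]  This replaces print's per-vertex
argument (p. 48 l. 44 – p. 49 l. 5) on the (H′) route. [cite: Mochizuki2012, Cor 2.3(iii) pp.48-49] -/
theorem inf_ker_ne_bot_towerLevels_of_isSlimGroup (hopen : T.LevelsOpen) (hnorm : T.LevelsNormal)
    (hslim : IsSlimGroup D.DeltaTp) (hK : D.ρTp.ker ≠ ⊥) :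
    ∀ i, (T.Jhat i).subgroupOf D.DeltaHat ⊓ D.ρHat.ker ≠ ⊥ := by
  intro i hbot
  have hJeq : D.levelTp (T.Jhat i) = ((T.Jhat i).subgroupOf D.DeltaHat).comap D.ιΔ := T.levelTp_eq_comap_ιΔ i
  haveI hJn : (D.levelTp (T.Jhat i)).Normal := by
    rw [hJeq]
    exact Subgroup.Normal.comap (hnorm i) _
  have hJo : IsOpen ((D.levelTp (T.Jhat i) : Subgroup D.DeltaTp) : Set D.DeltaTp) := by
    rw [hJeq, Subgroup.coe_comap]
    exact (hopen i).preimage D.continuous_ιΔ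
  have hKJ : D.ρTp.ker ⊓ D.levelTp (T.Jhat i) = ⊥ := by
    rw [eq_bot_iff]
    intro x hx
    have hmem := D.ιΔ_mem_inf_ker_of_mem_levelTp T i hx.2 hx.1
    rw [hbot, Subgroup.mem_bot] at hmem
    rw [Subgroup.mem_bot]
    exact D.ιΔ_injective (by rw [hmem, map_one])
  exact hK (eq_bot_of_isSlimGroup_of_inf_eq_bot hslim (D.levelTp (T.Jhat i)) D.ρTp.ker hJo hKJ)

/-- **The level-free input from a CUSP**, abstract form: if a cusp inertia group `I_x ⊆ Δ^tp_X` is identified with `Ẑ`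
(«`I_x ≅ Ẑ(1)`», [SemiAnbd] §6 p. 71) and its image in the profinite `Π̂_𝔾` lies in a closed pro-`Σ_c` subgroup with `p ∉ Σ_c`
(print: `I_x` maps into a cuspidal edge group of the pro-`Σ` semi-graph of anabelioids `𝔾`, `p ∉ Σ`, [IUTchI] §2 p. 47;
[SemiAnbd] Cor. 3.11 p. 48 «the decomposition groups at the nodes and cusps … are prime to `p`»), then `Δ^tp_X ↠ Π^tp_𝔾` is a
PROPER quotient: the non-trivial compact pro-`p` part of `I_x` dies. [cite: Mochizuki2012, Cor 2.3 p.47] -/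
theorem ker_ρTp_ne_bot_of_cusp (hρc : Continuous D.ρTp) [T2Space D.graph.Hat] [TotallyDisconnectedSpace D.graph.Hat]
    (hpp : D.p.Prime) (x : D.Cusp) (e : ↥(D.inertiaTp x) ≃ₜ* ZHat) {Sc : Set ℕ} (hpS : D.p ∉ Sc)
    (W : Subgroup D.graph.Hat) (hWc : IsClosed (W : Set D.graph.Hat)) (hW : IsProSigma Sc W)
    (hIW : ((D.inertiaTp x).map D.ρTp).map D.graph.ι ≤ W) : D.ρTp.ker ≠ ⊥ := by
  -- a non-trivial compact pro-`p` subgroup `Λ ⊆ I_x`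
  obtain ⟨Λ, -, hΛc, hΛne, hΛp⟩ :=
    exists_compact_proSigma_le_of_mulEquiv_zHat e hpp (Set.mem_singleton D.p) (⊤ : Subgroup ↥(D.inertiaTp x))
  haveI : CompactSpace Λ := isCompact_iff_compactSpace.mp hΛc
  -- the continuous homomorphism `Λ → Π̂_𝔾`
  let f : Λ →* D.graph.Hat := (D.graph.ι.comp D.ρTp).comp ((D.inertiaTp x).subtype.comp Λ.subtype)
  have hf : Continuous f :=
    D.graph.ι_continuous.comp (hρc.comp (continuous_subtype_val.comp continuous_subtype_val))
  have hfW : f.range ≤ W := by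
    rintro _ ⟨a, rfl⟩
    exact hIW ⟨D.ρTp ((a : D.inertiaTp x) : D.DeltaTp), ⟨(a : D.inertiaTp x), (a : D.inertiaTp x).2, rfl⟩, rfl⟩
  have h1 := monoidHom_apply_eq_one_of_isProSigma_singleton_of_not_mem f hf hΛp hpS W hWc hW hfW
  -- a non-trivial element of `Λ` lies in the kernel
  obtain ⟨a, haΛ, ha1⟩ : ∃ a ∈ Λ, a ≠ (1 : D.inertiaTp x) := by
    by_contra h
    push Not at h
    exact hΛne ((Subgroup.eq_bot_iff_forall _).mpr h)
  intro hbot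
  have hker : ((a : D.inertiaTp x) : D.DeltaTp) ∈ D.ρTp.ker := by
    rw [MonoidHom.mem_ker]
    apply D.graph.ι_injective
    rw [map_one]
    exact h1 ⟨a, haΛ⟩
  rw [hbot, Subgroup.mem_bot] at hker
  exact ha1 (Subtype.ext hker)

end Abstract

/-! ### C. At the genuine 𝔛-datum: slimness, level laws and continuity DISCHARGED -/

section Genuine

variable {p : ℕ} [Fact p.Prime] (X : TemperedCurve p) (d : X.GroupLevelData)
  (S : SpecialFibreData (X.toTemperedArithmeticGroup d)) (h36 : S.Gc.Prop36Hypotheses)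
  (Sigma SigmaHat : Set ℕ) (hsub : Sigma ⊆ SigmaHat) (hne : Sigma.Nonempty)
  (hprime : ∀ q ∈ SigmaHat, q.Prime) (hp : p ∉ Sigma)
  (TpH : Subgroup S.chart.G)
  (HatH : Subgroup (TemperedGraphGroupData.exists_completion_of_prop36 S.Gc h36 S.chart).choose)
  (hle : TpH.map (TemperedGraphGroupData.exists_completion_of_prop36 S.Gc h36
    S.chart).choose_spec.choose.toMonoidHom ≤ HatH)
  (cuspMeetsH : {x : X.Pt // X.IsCusp x} → Prop)
  (T : SpecialFibreTower X.DeltaTemp)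

/-- **`Δ^tp_X` of the genuine datum is temp-slim** — [SemiAnbd] Ex. 3.10 p. 45 «`Δ` [is] temp-slim», the recorded field
`isSlimGroup_ker` of the bridged group-level datum (`X.toTemperedArithmeticGroup d`), read on `Ker(Π^tp_X ↠ G_k)`.
[cite: MochizukiSemiAnbd2006, Ex 3.10 p.45] -/
theorem ofSpecialFibre_isSlimGroup_deltaTp :
    IsSlimGroup (ofSpecialFibre X d S h36 Sigma SigmaHat hsub hne hprime hp TpH HatH hle cuspMeetsH).DeltaTp := by
  change IsSlimGroup ↥(X.augGK.toMonoidHom.ker)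
  rw [OfSpecialFibre.ker_augGK_eq_delta X d]
  exact (X.toTemperedArithmeticGroup d).isSlimGroup_ker

/-- `Δ^tp_X ↠ Π^tp_𝔾` of the genuine datum (the admissible quotient of `S`) is continuous. [cite: MochizukiSemiAnbd2006, Ex 3.10 p.45] -/
theorem ofSpecialFibre_continuous_ρTp :
    Continuous (ofSpecialFibre X d S h36 Sigma SigmaHat hsub hne hprime hp TpH HatH hle cuspMeetsH).ρTp := by
  change Continuous (OfSpecialFibre.rhoTp X d S)
  refine S.admissible.continuous.comp ?_
  exact continuous_induced_rng.2 continuous_subtype_val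

/-- `Ker(Δ^tp_X ↠ Π^tp_𝔾) ≠ 1` at the genuine datum iff the admissible quotient `Δ^temp_X ↠ π₁^temp(G^c)` of `S` has
non-trivial kernel (same underlying elements). [cite: MochizukiSemiAnbd2006, Ex 3.10 p.45] -/
theorem ofSpecialFibre_ker_ρTp_ne_bot_iff :
    (ofSpecialFibre X d S h36 Sigma SigmaHat hsub hne hprime hp TpH HatH hle cuspMeetsH).ρTp.ker ≠ ⊥ ↔
      S.admissible.toMonoidHom.ker ≠ ⊥ := by
  change (OfSpecialFibre.rhoTp X d S).ker ≠ ⊥ ↔ _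
  rw [not_iff_not, OfSpecialFibre.rhoTp, MonoidHom.ker_eq_bot_iff, MonoidHom.ker_eq_bot_iff, MonoidHom.coe_comp]
  exact Function.Injective.of_comp_iff' _
    (MulEquiv.subgroupCongr (OfSpecialFibre.ker_augGK_eq_delta X d)).bijective

/-- **(y) at every level of the special-fibre tower of the genuine datum from «the admissible quotient is proper»**:
levels open/normal (`towerOfSpecialFibreTower_levelsOpen/_levelsNormal`) and temp-slimness of `Δ^tp_X` are THEOREMS here;
the one displayed input is `hK : Ker(S.admissible) ≠ 1`. [cite: Mochizuki2012, Cor 2.3(iii) pp.48-49] -/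
theorem inf_ker_ne_bot_towerLevels_ofSpecialFibre_of_admissibleKer_ne_bot (hK : S.admissible.toMonoidHom.ker ≠ ⊥) :
    ∀ i, ((OfSpecialFibre.towerOfSpecialFibreTower X d T Sigma SigmaHat hsub hne hprime S h36 hp TpH HatH hle
        cuspMeetsH).Jhat i).subgroupOf
        (ofSpecialFibre X d S h36 Sigma SigmaHat hsub hne hprime hp TpH HatH hle cuspMeetsH).DeltaHat ⊓
      (ofSpecialFibre X d S h36 Sigma SigmaHat hsub hne hprime hp TpH HatH hle cuspMeetsH).ρHat.ker ≠ ⊥ :=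
  inf_ker_ne_bot_towerLevels_of_isSlimGroup _ _
    (OfSpecialFibre.towerOfSpecialFibreTower_levelsOpen X d T Sigma SigmaHat hsub hne hprime S h36 hp TpH HatH hle
      cuspMeetsH)
    (OfSpecialFibre.towerOfSpecialFibreTower_levelsNormal X d T Sigma SigmaHat hsub hne hprime S h36 hp TpH HatH hle
      cuspMeetsH)
    (ofSpecialFibre_isSlimGroup_deltaTp X d S h36 Sigma SigmaHat hsub hne hprime hp TpH HatH hle cuspMeetsH)
    ((ofSpecialFibre_ker_ρTp_ne_bot_iff X d S h36 Sigma SigmaHat hsub hne hprime hp TpH HatH hle cuspMeetsH).mpr hK)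

/-- **«The admissible quotient is proper» from a CUSP at the genuine datum**: `I_x ≅ Ẑ(1)` is a THEOREM here
(`ofSpecialFibre_nonempty_inertiaTpEquivZHat`), `Π̂_𝔾` is profinite and `ρ^tp` continuous; the displayed input is a closed
pro-`Σ_c` subgroup `W ⊆ Π̂_𝔾`, `p ∉ Σ_c`, containing the image of `I_x`. [cite: Mochizuki2012, Cor 2.3 p.47] -/
theorem admissibleKer_ne_bot_ofSpecialFibre_of_cusp (x : {x : X.Pt // X.IsCusp x}) {Sc : Set ℕ} (hpS : p ∉ Sc)
    (W : Subgroup (ofSpecialFibre X d S h36 Sigma SigmaHat hsub hne hprime hp TpH HatH hle cuspMeetsH).graph.Hat)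
    (hWc : IsClosed (W : Set (ofSpecialFibre X d S h36 Sigma SigmaHat hsub hne hprime hp TpH HatH hle cuspMeetsH).graph.Hat))
    (hW : IsProSigma Sc W)
    (hIW : (((ofSpecialFibre X d S h36 Sigma SigmaHat hsub hne hprime hp TpH HatH hle cuspMeetsH).inertiaTp x).map
        (ofSpecialFibre X d S h36 Sigma SigmaHat hsub hne hprime hp TpH HatH hle cuspMeetsH).ρTp).map
        (ofSpecialFibre X d S h36 Sigma SigmaHat hsub hne hprime hp TpH HatH hle cuspMeetsH).graph.ι ≤ W) :
    S.admissible.toMonoidHom.ker ≠ ⊥ := by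
  haveI := ofSpecialFibre_t2Space_graphHat X d S h36 Sigma SigmaHat hsub hne hprime hp TpH HatH hle cuspMeetsH
  haveI : TotallyDisconnectedSpace
      (ofSpecialFibre X d S h36 Sigma SigmaHat hsub hne hprime hp TpH HatH hle cuspMeetsH).graph.Hat :=
    (OfSpecialFibre.iotaG_isProfiniteCompletion X d S h36).totallyDisconnectedSpace
  refine (ofSpecialFibre_ker_ρTp_ne_bot_iff X d S h36 Sigma SigmaHat hsub hne hprime hp TpH HatH hle cuspMeetsH).mp ?_
  exact ker_ρTp_ne_bot_of_cusp _
    (ofSpecialFibre_continuous_ρTp X d S h36 Sigma SigmaHat hsub hne hprime hp TpH HatH hle cuspMeetsH)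
    (Fact.out : p.Prime) x
    (ofSpecialFibre_nonempty_inertiaTpEquivZHat X d S h36 Sigma SigmaHat hsub hne hprime hp TpH HatH hle
      cuspMeetsH x).some hpS W hWc hW hIW

end Genuine

/-! ### D. Cor. 2.3 (i)–(v) at the record's `ℍ`, (H′) route, with (y) from the ONE level-free input -/

section Block

variable {p : ℕ} [Fact p.Prime] (X : TemperedCurve p) (d : X.GroupLevelData)
  (S : SpecialFibreData (X.toTemperedArithmeticGroup d)) (h36 : S.Gc.Prop36Hypotheses)
  (Sigma SigmaHat : Set ℕ) (hsub : Sigma ⊆ SigmaHat) (hne : Sigma.Nonempty)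
  (hprime : ∀ q ∈ SigmaHat, q.Prime) (hp : p ∉ Sigma)
  (TpH : Subgroup S.chart.G)
  (cuspMeetsH : {x : X.Pt // X.IsCusp x} → Prop)
  (T : SpecialFibreTower X.DeltaTemp)

/-- **[IUTchI] Cor. 2.3 (i)–(v) AS TYPED at the genuine datum for the record's `ℍ := P.H`, every
`Π^tp_ℍ ∈ decompSubgroups S.chart P.H`, (H′) route, with `hA`, `hB` DISCHARGED and (y) DERIVED from the ONE level-free input
`hK : Ker(S.admissible) ≠ 1`** («the admissible quotient `Δ^temp_X ↠ π₁^temp(G^c)` is proper»); remaining: the origin datum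
`hind`, the FACT-INSTANCE `hcoh`, (x) `hΓ`/`hι`, (z) `hSig`. [cite: Mochizuki2012, Cor 2.3 pp.47-50] -/
theorem cor23_i_to_v_ofSpecialFibre_closureH_of_piData_of_mem_decompSubgroups_of_hPrime_of_admissibleKer_ne_bot
    (P : SpecialFibreTower.PiData X d S T) (hcoh : S.Gc.IsCoherent) (hTpH : TpH ∈ S.chart.decompSubgroups P.H)
    (hind : P.ActGraphInduces)
    {Γ : Type*} [Group Γ] [IsFreeGroup Γ] (hΓ : ∃ x y : Γ, x * y ≠ y * x) {Sig : Set ℕ}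
    {ι : Γ →* (ofSpecialFibre X d S h36 Sigma SigmaHat hsub hne hprime hp TpH
      ((TpH.map (TemperedGraphGroupData.exists_completion_of_prop36 S.Gc h36
        S.chart).choose_spec.choose.toMonoidHom).topologicalClosure) (Subgroup.le_topologicalClosure _) cuspMeetsH).DeltaHat}
    (hι : IsProSigmaCompletion Sig ι) (hSig : ∀ m : ℕ, ∃ q ∈ Sig, q.Prime ∧ m < q)
    (hK : S.admissible.toMonoidHom.ker ≠ ⊥) :
    ((ofSpecialFibre X d S h36 Sigma SigmaHat hsub hne hprime hp TpH
      ((TpH.map (TemperedGraphGroupData.exists_completion_of_prop36 S.Gc h36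
        S.chart).choose_spec.choose.toMonoidHom).topologicalClosure) (Subgroup.le_topologicalClosure _) cuspMeetsH).Cor23i ∧
      (ofSpecialFibre X d S h36 Sigma SigmaHat hsub hne hprime hp TpH
      ((TpH.map (TemperedGraphGroupData.exists_completion_of_prop36 S.Gc h36
        S.chart).choose_spec.choose.toMonoidHom).topologicalClosure) (Subgroup.le_topologicalClosure _) cuspMeetsH).Cor23ii ∧
      (ofSpecialFibre X d S h36 Sigma SigmaHat hsub hne hprime hp TpH
      ((TpH.map (TemperedGraphGroupData.exists_completion_of_prop36 S.Gc h36
        S.chart).choose_spec.choose.toMonoidHom).topologicalClosure) (Subgroup.le_topologicalClosure _) cuspMeetsH).Cor23iii ∧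
      (ofSpecialFibre X d S h36 Sigma SigmaHat hsub hne hprime hp TpH
      ((TpH.map (TemperedGraphGroupData.exists_completion_of_prop36 S.Gc h36
        S.chart).choose_spec.choose.toMonoidHom).topologicalClosure) (Subgroup.le_topologicalClosure _) cuspMeetsH).Cor23iv) ∧
      (ofSpecialFibre X d S h36 Sigma SigmaHat hsub hne hprime hp TpH
      ((TpH.map (TemperedGraphGroupData.exists_completion_of_prop36 S.Gc h36
        S.chart).choose_spec.choose.toMonoidHom).topologicalClosure) (Subgroup.le_topologicalClosure _) cuspMeetsH).Cor23v :=
  cor23_i_to_v_ofSpecialFibre_closureH_of_piData_of_mem_decompSubgroups_of_hPrime X d S h36 Sigma SigmaHat hsub hne hprime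
    hp TpH cuspMeetsH T P hcoh hTpH hind hΓ hι hSig
    (inf_ker_ne_bot_towerLevels_ofSpecialFibre_of_admissibleKer_ne_bot X d S h36 Sigma SigmaHat hsub hne hprime hp TpH _ _
      cuspMeetsH T hK)

end Block

end StableCurveTemperedData

end Literature.IUT.HodgeTheaters

end
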